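import Summits.QuantumFields.BalabanUV.Beta.StepResidualFF

/-!
# (J2)-ff PAIRED: the field–field rows of the step residual REPRODUCE every finite step-lattice source with block-constant codifferential —
# `Σ_{(b,w) ∈ T} a(b,w)·(bhKStep (j+1) ∘ KInvStep Lc (j+1))(x, w; inl κ, inl b) = a(κ, x)`
# (β sub-cell, row BETA-an2 = BINDER-OWNERS row D1, gen 15; leaf L1.c-ff of `gen15/SKELETON-D1-hR.v2.1.md` in the form (J3) consumes)

HONEST FRAMING (cell charter, verbatim): «discharging BetaPertH makes Balaban's UV stability UNCONDITIONAL — a real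
constructive-QFT result; it is NOT the continuum limit and NOT the Clay problem.»  DERIVED cell leaf (pub-balaban β sub-cell, lane
an2 gen 15); no statement of Bałaban's papers is typed here, no `[cite:]` tag, no `Prop` fact; it instantiates no binder of the
β-function wall by itself.  NOT `BetaPertH`; NOT continuum; NOT Clay.

## What is here ([folklore]; `M := Lc^{j+1}`, `N := Lc^{j+2} = M·Lc`)
* §1 THE LIFTED FINE SOURCE of a finite step-lattice source `(T, a)` through the column legs of `dec M`: index set `liftIdx`, points
  `liftPt`, support `liftSet := image`, weights `liftWt` (fibre sums), and the re-indexing lemma `sum_liftSet` (`Finset.sum_image'`);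
  the lifted force IS the adjoint block-contour sum `𝒬_Mᵀ ǎ` (`δSum_lift_eq_contourSumAdj`, by the adjointness `lip1_contourSumAdj` against
  bond indicators), hence its codifferential is `M`-block-constant always and `N`-block-constant when `codiff₁ ǎ` is `Lc`-block-constant
  (`isBlockConst_codiff₁_δSum_lift_M/_N`);
* §2 **`sum_mul_comp_bhKStep_KInvStep_inl_inl`**: for such a source, `Σ_{(b,w) ∈ T} a(b,w)·(bhKStep (j+1) ∘ KInvStep Lc (j+1))(x,w; inl κ, inl b)
  = a(κ, x)` — by the action lemma (`BorderedHessianStepStraight`), the column lemmas (`StepResidualBorder`), the step identity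
  `StepResidualFF.tsum_contourSum_GcolSum_mul_wΦ` for the lifted source, `GamΦ_eq_neg_wH` and `contourSum_Hcol`.
Consumer: the absorption (J3) with `a := rowBm ρ Lc β z` (codifferential block-constant: `GaugeMultiplierBlockMean.isBlockConst_codiff₁_rowBm`).
All declarations `[folklore]`; axioms standard.  Provenance: b2b-balaban β sub-cell, unit beta-an2 gen 15, 2026-08-20 (v1); over `StepResidualFF`
BY NAME; no existing file touched.
-/

open Finset
open scoped BigOperators
open Literature.Probability.LatticeModels (TorusSite Torus.proj Torus.proj_apply)
open Literature.MathematicalPhysics.QuantumFieldTheory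
open Literature.MathematicalPhysics.QuantumFieldTheory.Balaban1983to89
open Literature.MathematicalPhysics.QuantumFieldTheory.Balaban1983to89.Beta
open B12Sec2to5 (l1 l1_nonneg Decay510)
open ExpKernelCalculus (MKer Decays comp)
open AffineAveraging (Form0 Form1 Form2 box toSite unitVec unitVec_apply dz curv curvAdj codiff₁ contourSum blockSum)
open AffineReproduction (contourSumAdj IsBlockConst)
open KKTFluctuationKernel (delta1 delta1_apply Gam GamΦ GamM Gam_Q GamM_M)
open KKTFluctuationEnergy (lip0 lip1 lip1_contourSumAdj abs_contourSumAdj_le summable_mul_of_bdd summable_mul_of_bdd' contourSumAdj_eq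
  quo_zsmul_add_toSite Gcol Mcol Φcol δcol GcolSum)
open KKTFluctuationUnique (abs_le_of_decay510)
open DecimatedMomentLimit (summable_of_decay510)
open KernelSpecInstance (wH wΦ decay_wΦ)
open LatticeForm (quo)
open BlochFibreUniqueness (quo_add_zsmul)
open OneStepResolventKernel (Fib KInv KInv_inl_inl KInv_inr_inl_coarse KInv_inr_inr_coarse quo_zsmul eq_zsmul_quo_of_proj proj_zsmul)
open OneStepKernelFamily (KInvStep dec legSet legW legPt LegIdx)
open StepDriftWitness (sum_LegIdx_eq_contourSum)
open ResolventComposition (δSum McolSum ΦcolSum GcolSum_bdd_summable Hcol Hcol_apply HΦcol HΦcol_apply contourSum_Hcol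
  Hcol_bdd_summable GamΦ_eq_neg_wH codiff₁_contourSumAdj contourSum_mul contourSum_const_mul contourSum_finset_sum zsmul_pow_succ
  exists_abs_KInvStep_le quo_zsmul' dec_inr_inl)
open ResolventCompositionStepB (abs_contourSum_le)
open BalabanCompositeJets (summable_contourSum)
open BalabanStepJetsSucc (E2 wVH)
open Summit.QuantumFields.BalabanUV.Beta.TameKernelCalculus
open Summit.QuantumFields.BalabanUV.Beta.AxialDressingRooted (KInvStep_inr_off' one_le_of_neZero)

namespace Summit.QuantumFields.BalabanUV.Beta.BorderedHessian

noncomputable section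

variable {d : ℕ}

/-! ## §1 The lifted fine source of a finite step-lattice source -/

section Lift

variable (M : ℕ) (T : Finset (Fin (d + 1) × (Fin (d + 1) → ℤ))) (a : Fin (d + 1) × (Fin (d + 1) → ℤ) → ℝ)

/-- [folklore] Index set of the lifted source: step bonds of `T` × column legs of `dec M`. -/
def liftIdx : Finset ((Fin (d + 1) × (Fin (d + 1) → ℤ)) × ((Fin (d + 1) → ℕ) × ℕ)) := T ×ˢ LegIdx d M

/-- [folklore] The fine bond of a lifted index: `((b, w), i) ↦ (b, legPt M (inl b) w i)`. -/
def liftPt : (Fin (d + 1) × (Fin (d + 1) → ℤ)) × ((Fin (d + 1) → ℕ) × ℕ) → Fin (d + 1) × (Fin (d + 1) → ℤ) :=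
  fun t => (t.1.1, legPt M (Sum.inl t.1.1) t.1.2 t.2)

/-- [folklore] The support of the lifted source. -/
def liftSet : Finset (Fin (d + 1) × (Fin (d + 1) → ℤ)) := (liftIdx M T).image (liftPt M)

/-- [folklore] The weights of the lifted source: fibre sums of `a`. -/
def liftWt : Fin (d + 1) × (Fin (d + 1) → ℤ) → ℝ :=
  fun p => ∑ t ∈ (liftIdx M T).filter (fun t => liftPt M t = p), a t.1

variable {M T a}

/-- [folklore] **RE-INDEXING**: a weighted sum over the lifted support is the double sum over step bonds and column legs. -/
theorem sum_liftSet (G : Fin (d + 1) → (Fin (d + 1) → ℤ) → ℝ) :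
    ∑ p ∈ liftSet M T, liftWt M T a p * G p.1 p.2 =
      ∑ q ∈ T, a q * ∑ i ∈ LegIdx d M, G q.1 (legPt M (Sum.inl q.1) q.2 i) := by
  classical
  unfold liftSet liftWt
  rw [Finset.sum_image' (fun t => a t.1 * G (liftPt M t).1 (liftPt M t).2)]
  · unfold liftIdx
    rw [Finset.sum_product]
    refine Finset.sum_congr rfl fun q _ => ?_
    rw [Finset.mul_sum]
    rfl
  · intro t _
    rw [Finset.sum_mul]
    refine Finset.sum_congr rfl fun t' ht' => ?_
    rw [(Finset.mem_filter.1 ht').2]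

variable {N : ℕ} [NeZero N]

/-- [folklore] The covariance field of the lifted source. -/
theorem GcolSum_lift (l : Fin (d + 1)) (y : Fin (d + 1) → ℤ) :
    GcolSum (N := N) (liftSet M T) (liftWt M T a) l y =
      ∑ q ∈ T, a q * ∑ i ∈ LegIdx d M, Gam (N := N) l y q.1 (legPt M (Sum.inl q.1) q.2 i) :=
  sum_liftSet (fun b P => Gcol (N := N) b P l y)

/-- [folklore] The constraint multiplier of the lifted source. -/
theorem ΦcolSum_lift (l : Fin (d + 1)) (y : Fin (d + 1) → ℤ) :
    ΦcolSum (N := N) (liftSet M T) (liftWt M T a) l y =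
      ∑ q ∈ T, a q * ∑ i ∈ LegIdx d M, GamΦ (N := N) l y q.1 (legPt M (Sum.inl q.1) q.2 i) :=
  sum_liftSet (fun b P => Φcol (N := N) b P l y)

omit [NeZero N] in
/-- [folklore] The force of the lifted source. -/
theorem δSum_lift (μ : Fin (d + 1)) (P : Fin (d + 1) → ℤ) :
    δSum (liftSet M T) (liftWt M T a) μ P = ∑ q ∈ T, a q * ∑ i ∈ LegIdx d M, δcol q.1 (legPt M (Sum.inl q.1) q.2 i) μ P :=
  sum_liftSet (fun b Q => δcol b Q μ P)

/-- [folklore] **THE FORCE OF THE LIFTED SOURCE IS THE ADJOINT BLOCK-CONTOUR SUM** `𝒬_Mᵀ ǎ` of the step-lattice source (`a` vanishing off `T`). -/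
theorem δSum_lift_eq_contourSumAdj [NeZero M] (hT : ∀ q, q ∉ T → a q = 0) :
    δSum (liftSet M T) (liftWt M T a) = contourSumAdj M (fun l w => a (l, w)) := by
  classical
  obtain ⟨C, hC⟩ : ∃ C : ℝ, ∀ l w, |(fun l w => a (l, w)) l w| ≤ C := by
    refine ⟨∑ q ∈ T, |a q|, fun l w => ?_⟩
    change |a (l, w)| ≤ _
    by_cases h : (l, w) ∈ T
    · exact Finset.single_le_sum (f := fun q => |a q|) (fun q _ => abs_nonneg _) h
    · rw [hT _ h, abs_zero]; exact Finset.sum_nonneg fun q _ => abs_nonneg _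
  funext μ P
  rw [← lip1_delta1_left μ P (contourSumAdj M fun l w => a (l, w)), lip1_contourSumAdj (N := M) (summable_delta1 μ P) hC, δSum_lift]
  -- the tsum is a finite sum over the second components of `T`
  have hz : ∀ w, w ∉ T.image Prod.snd → ∑ l : Fin (d + 1), (fun l w => a (l, w)) l w * contourSum M (delta1 μ P) l w = 0 := by
    intro w hw
    refine Finset.sum_eq_zero fun l _ => ?_
    change a (l, w) * _ = 0
    rw [hT (l, w) (fun h => hw (Finset.mem_image.2 ⟨(l, w), h, rfl⟩)), zero_mul]
  rw [tsum_eq_sum (s := T.image Prod.snd) (fun w hw => hz w hw)]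
  -- both sides as sums over `univ ×ˢ T.image snd`
  have e1 : ∑ w ∈ T.image Prod.snd, ∑ l : Fin (d + 1), (fun l w => a (l, w)) l w * contourSum M (delta1 μ P) l w =
      ∑ q ∈ (Finset.univ : Finset (Fin (d + 1))) ×ˢ T.image Prod.snd, a q * contourSum M (delta1 μ P) q.1 q.2 := by
    rw [Finset.sum_product, Finset.sum_comm]
  have hsub : T ⊆ (Finset.univ : Finset (Fin (d + 1))) ×ˢ T.image Prod.snd := fun q hq =>
    Finset.mem_product.2 ⟨Finset.mem_univ _, Finset.mem_image.2 ⟨q, hq, rfl⟩⟩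
  rw [e1, ← Finset.sum_subset hsub (fun q _ hq => by rw [hT q hq, zero_mul])]
  refine Finset.sum_congr rfl fun q _ => ?_
  congr 1
  rw [← sum_LegIdx_eq_contourSum]
  refine Finset.sum_congr rfl fun i _ => ?_
  simp only [delta1_apply, KKTFluctuationEnergy.δcol]
  by_cases h : μ = q.1 ∧ P = legPt M (Sum.inl q.1) q.2 i
  · rw [if_pos h, if_pos ⟨h.1.symm, h.2.symm⟩]
  · rw [if_neg h, if_neg (fun h' => h ⟨h'.1.symm, h'.2.symm⟩)]

/-- [folklore] **`M`-BLOCK-CONSTANCY OF THE LIFTED FORCE'S CODIFFERENTIAL** (automatic). -/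
theorem isBlockConst_codiff₁_δSum_lift_M [NeZero M] (hT : ∀ q, q ∉ T → a q = 0) :
    IsBlockConst M (codiff₁ (δSum (liftSet M T) (liftWt M T a))) := by
  intro y b hb
  rw [δSum_lift_eq_contourSumAdj hT, codiff₁_contourSumAdj, codiff₁_contourSumAdj, quo_zsmul_add_toSite (N := M) y hb, quo_zsmul']

/-- [folklore] The block index of a box point of the composite blocking lies in the box of the quotient blocking. -/
theorem quo_toSite_mem_box {L : ℕ} [NeZero M] {b : Fin (d + 1) → ℕ} (hb : b ∈ box (d + 1) (M * L)) :
    ∃ b' ∈ box (d + 1) L, quo M (toSite b) = toSite b' := by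
  refine ⟨fun i => b i / M, ?_, ?_⟩
  · simp only [AffineAveraging.box, Fintype.mem_piFinset, Finset.mem_range] at hb ⊢
    exact fun i => Nat.div_lt_of_lt_mul (hb i)
  · funext i
    simp only [LatticeForm.quo, AffineAveraging.toSite]
    exact (Int.natCast_div (b i) M).symm

/-- [folklore] **`N`-BLOCK-CONSTANCY OF THE LIFTED FORCE'S CODIFFERENTIAL** (`N = M·L`) when `codiff₁ ǎ` is `L`-block-constant. -/
theorem isBlockConst_codiff₁_δSum_lift_N {L : ℕ} [NeZero M] [NeZero L] (hN : N = M * L) (hT : ∀ q, q ∉ T → a q = 0)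
    (hbc : IsBlockConst L (codiff₁ (fun l w => a (l, w)))) :
    IsBlockConst N (codiff₁ (δSum (liftSet M T) (liftWt M T a))) := by
  subst hN
  intro y b hb
  obtain ⟨b', hb', hq⟩ := quo_toSite_mem_box (M := M) hb
  rw [δSum_lift_eq_contourSumAdj hT, codiff₁_contourSumAdj, codiff₁_contourSumAdj]
  have e1 : quo M ((((M * L : ℕ) : ℤ)) • y + toSite b) = (L : ℤ) • y + toSite b' := by
    rw [show (((M * L : ℕ) : ℤ)) • y + toSite b = toSite b + (M : ℤ) • ((L : ℤ) • y) by
      rw [smul_smul, ← Nat.cast_mul]; exact add_comm _ _, quo_add_zsmul, hq]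
    exact add_comm _ _
  have e2 : quo M ((((M * L : ℕ) : ℤ)) • y) = (L : ℤ) • y := by
    rw [show (((M * L : ℕ) : ℤ)) • y = (M : ℤ) • ((L : ℤ) • y) by rw [smul_smul, ← Nat.cast_mul], quo_zsmul']
  rw [e1, e2]
  exact hbc y b' hb'

end Lift

/-! ## §2 The field–field rows of the step residual reproduce sources with block-constant codifferential -/

section Pair

variable {Lc : ℕ} [NeZero Lc]

/-- [folklore] `𝒬ᵀ_L` through a finite weighted sum of coarse 1-forms. -/
theorem contourSumAdj_finset_sum_mul {ι : Type*} (L : ℕ) (s : Finset ι) (c : ι → ℝ) (φ : ι → Form1 (d + 1) ℝ)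
    (κ : Fin (d + 1)) (x : Fin (d + 1) → ℤ) :
    contourSumAdj L (fun l y => ∑ q ∈ s, c q * φ q l y) κ x = ∑ q ∈ s, c q * contourSumAdj L (φ q) κ x := by
  simp only [contourSumAdj_eq, Finset.mul_sum]
  rw [Finset.sum_comm]

/-- [folklore] The field–field columns of `KInvStep Lc (j+1)` paired with a step-lattice source: `M^{−2(d+2)}·𝒬_M U_N`,
`U_N` the covariance field of the LIFTED source at level `N = Lc^{j+2}`. -/
theorem sum_mul_KInvStep_inl_inl (j : ℕ) (T : Finset (Fin (d + 1) × (Fin (d + 1) → ℤ)))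
    (a : Fin (d + 1) × (Fin (d + 1) → ℤ) → ℝ) (y : Fin (d + 1) → ℤ) (l : Fin (d + 1)) :
    ∑ q ∈ T, a q * KInvStep (d := d) Lc (j + 1) y q.2 (Sum.inl l) (Sum.inl q.1) =
      ((((Lc ^ (j + 1) : ℕ) : ℝ) ^ (d + 2))⁻¹ * (((Lc ^ (j + 1) : ℕ) : ℝ) ^ (d + 2))⁻¹) *
        contourSum (Lc ^ (j + 1)) (GcolSum (N := Lc ^ (j + 1 + 1)) (liftSet (Lc ^ (j + 1)) T) (liftWt (Lc ^ (j + 1)) T a)) l y := by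
  have eU : GcolSum (N := Lc ^ (j + 1 + 1)) (liftSet (Lc ^ (j + 1)) T) (liftWt (Lc ^ (j + 1)) T a) =
      fun l' w' => ∑ q ∈ T, a q * ∑ i ∈ LegIdx d (Lc ^ (j + 1)),
        (fun l'' w'' => Gam (N := Lc ^ (j + 1 + 1)) l'' w'' q.1 (legPt (Lc ^ (j + 1)) (Sum.inl q.1) q.2 i)) l' w' := by
    funext l' w'
    exact GcolSum_lift l' w'
  rw [eU, contourSum_finset_sum, Finset.mul_sum]
  refine Finset.sum_congr rfl fun q _ => ?_
  have eK := congrFun (congrFun (fcol_KInvStep_inl (d := d) (Lc := Lc) (j + 1) q.2 q.1) l) y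
  rw [fcol_apply] at eK
  rw [eK, contourSum_const_mul, contourSum_finset_sum]
  simp only [Finset.mul_sum]
  refine Finset.sum_congr rfl fun i _ => ?_
  ring

/-- [folklore] The field–multiplier... no: the MULTIPLIER COLUMNS `mcol` of `KInvStep Lc (j+1)` at field indices, paired with a step-lattice
source: `M^{−(d+2)}·Φ^{U_N}`. -/
theorem sum_mul_mcol_KInvStep_inl (j : ℕ) (T : Finset (Fin (d + 1) × (Fin (d + 1) → ℤ)))
    (a : Fin (d + 1) × (Fin (d + 1) → ℤ) → ℝ) (l : Fin (d + 1)) (y' : Fin (d + 1) → ℤ) :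
    ∑ q ∈ T, a q * mcol Lc (KInvStep (d := d) Lc (j + 1)) q.2 (Sum.inl q.1) l y' =
      (((Lc ^ (j + 1) : ℕ) : ℝ) ^ (d + 2))⁻¹ *
        ΦcolSum (N := Lc ^ (j + 1 + 1)) (liftSet (Lc ^ (j + 1)) T) (liftWt (Lc ^ (j + 1)) T a) l y' := by
  rw [ΦcolSum_lift (N := Lc ^ (j + 1 + 1)) (M := Lc ^ (j + 1)) (T := T) (a := a) l y']
  simp only [Finset.mul_sum]
  refine Finset.sum_congr rfl fun q _ => ?_
  rw [mcol_apply]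
  unfold OneStepKernelFamily.KInvStep
  rw [dec_inr_inl]
  simp only [Finset.mul_sum]
  refine Finset.sum_congr rfl fun i _ => ?_
  rw [zsmul_pow_succ, KInv_inr_inl_coarse]
  ring

/-- [folklore] **(J2)-ff PAIRED — THE FIELD–FIELD ROWS OF THE STEP RESIDUAL REPRODUCE EVERY FINITE STEP-LATTICE SOURCE WITH
`Lc`-BLOCK-CONSTANT CODIFFERENTIAL**: `Σ_{q ∈ T} a(q)·(bhKStep (j+1) ∘ KInvStep Lc (j+1))(x, q.2; inl κ, inl q.1) = a(κ, x)`. -/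
theorem sum_mul_comp_bhKStep_KInvStep_inl_inl (j : ℕ) (T : Finset (Fin (d + 1) × (Fin (d + 1) → ℤ)))
    (a : Fin (d + 1) × (Fin (d + 1) → ℤ) → ℝ) (hT : ∀ q, q ∉ T → a q = 0)
    (hbc : IsBlockConst Lc (codiff₁ (fun l w => a (l, w)))) (x : Fin (d + 1) → ℤ) (κ : Fin (d + 1)) :
    ∑ q ∈ T, a q * comp (bhKStep d Lc (j + 1)) (KInvStep (d := d) Lc (j + 1)) x q.2 (Sum.inl κ) (Sum.inl q.1) = a (κ, x) := by
  have hN : Lc ^ (j + 1 + 1) = Lc ^ (j + 1) * Lc := pow_succ Lc (j + 1)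
  obtain ⟨B, hB⟩ := exists_abs_KInvStep_le Lc (d := d) (j + 1)
  obtain ⟨δ, C, hδ, hdec⟩ := decay_wΦ (N := Lc ^ (j + 1)) (d := d)
  have hwΦs : ∀ l, Summable fun y => wΦ (N := Lc ^ (j + 1)) κ l (x - y) :=
    fun l => (summable_of_decay510 hδ (hdec κ l)).comp_injective sub_right_injective
  have hX : ∀ q : Fin (d + 1) × (Fin (d + 1) → ℤ), Summable fun y => ∑ l : Fin (d + 1),
      wΦ (N := Lc ^ (j + 1)) κ l (x - y) * KInvStep (d := d) Lc (j + 1) y q.2 (Sum.inl l) (Sum.inl q.1) :=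
    fun q => summable_sum fun l _ => summable_mul_of_bdd' (hwΦs l) (fun y => hB _ _ _ _)
  -- Step A: the action lemma, term by term
  have eA : ∀ q ∈ T, a q * comp (bhKStep d Lc (j + 1)) (KInvStep (d := d) Lc (j + 1)) x q.2 (Sum.inl κ) (Sum.inl q.1) =
      wVH d Lc (j + 1) * (a q * ∑' y, ∑ l : Fin (d + 1),
        wΦ (N := Lc ^ (j + 1)) κ l (x - y) * KInvStep (d := d) Lc (j + 1) y q.2 (Sum.inl l) (Sum.inl q.1)) -
      stepScale d Lc (j + 1) * (a q * contourSumAdj Lc (mcol Lc (KInvStep (d := d) Lc (j + 1)) q.2 (Sum.inl q.1)) κ x) := by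
    intro q _
    rw [comp_bhKStep_succ_inl j _ x q.2 κ (Sum.inl q.1) (hX q)]
    ring
  rw [Finset.sum_congr rfl eA, Finset.sum_sub_distrib, ← Finset.mul_sum, ← Finset.mul_sum]
  -- Step B: the field part
  have eB : ∑ q ∈ T, a q * ∑' y, ∑ l : Fin (d + 1),
        wΦ (N := Lc ^ (j + 1)) κ l (x - y) * KInvStep (d := d) Lc (j + 1) y q.2 (Sum.inl l) (Sum.inl q.1) =
      ((((Lc ^ (j + 1) : ℕ) : ℝ) ^ (d + 2))⁻¹ * (((Lc ^ (j + 1) : ℕ) : ℝ) ^ (d + 2))⁻¹) *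
        ∑' y, ∑ l : Fin (d + 1), contourSum (Lc ^ (j + 1))
          (GcolSum (N := Lc ^ (j + 1 + 1)) (liftSet (Lc ^ (j + 1)) T) (liftWt (Lc ^ (j + 1)) T a)) l y *
          wΦ (N := Lc ^ (j + 1)) κ l (x - y) := by
    have e1 : ∀ q ∈ T, a q * ∑' y, ∑ l : Fin (d + 1),
        wΦ (N := Lc ^ (j + 1)) κ l (x - y) * KInvStep (d := d) Lc (j + 1) y q.2 (Sum.inl l) (Sum.inl q.1) =
        ∑' y, a q * ∑ l : Fin (d + 1),
          wΦ (N := Lc ^ (j + 1)) κ l (x - y) * KInvStep (d := d) Lc (j + 1) y q.2 (Sum.inl l) (Sum.inl q.1) :=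
      fun q _ => (tsum_mul_left).symm
    rw [Finset.sum_congr rfl e1, ← Summable.tsum_finsetSum (fun q _ => (hX q).mul_left (a q)), ← tsum_mul_left]
    refine tsum_congr fun y => ?_
    have e2 : ∑ q ∈ T, a q * ∑ l : Fin (d + 1),
        wΦ (N := Lc ^ (j + 1)) κ l (x - y) * KInvStep (d := d) Lc (j + 1) y q.2 (Sum.inl l) (Sum.inl q.1) =
        ∑ l : Fin (d + 1), wΦ (N := Lc ^ (j + 1)) κ l (x - y) *
          ∑ q ∈ T, a q * KInvStep (d := d) Lc (j + 1) y q.2 (Sum.inl l) (Sum.inl q.1) := by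
      simp only [Finset.mul_sum]
      rw [Finset.sum_comm]
      refine Finset.sum_congr rfl fun l _ => Finset.sum_congr rfl fun q _ => by ring
    rw [e2, Finset.mul_sum]
    refine Finset.sum_congr rfl fun l _ => ?_
    rw [sum_mul_KInvStep_inl_inl]
    ring
  -- Step C: the multiplier part
  have eC : ∑ q ∈ T, a q * contourSumAdj Lc (mcol Lc (KInvStep (d := d) Lc (j + 1)) q.2 (Sum.inl q.1)) κ x =
      (((Lc ^ (j + 1) : ℕ) : ℝ) ^ (d + 2))⁻¹ * contourSumAdj Lc
        (ΦcolSum (N := Lc ^ (j + 1 + 1)) (liftSet (Lc ^ (j + 1)) T) (liftWt (Lc ^ (j + 1)) T a)) κ x := by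
    rw [← contourSumAdj_finset_sum_mul]
    have e : (fun l y => ∑ q ∈ T, a q * mcol Lc (KInvStep (d := d) Lc (j + 1)) q.2 (Sum.inl q.1) l y) =
        fun l y => (((Lc ^ (j + 1) : ℕ) : ℝ) ^ (d + 2))⁻¹ *
          ΦcolSum (N := Lc ^ (j + 1 + 1)) (liftSet (Lc ^ (j + 1)) T) (liftWt (Lc ^ (j + 1)) T a) l y := by
      funext l y
      exact sum_mul_mcol_KInvStep_inl j T a l y
    rw [e]
    simp only [contourSumAdj_eq, Finset.mul_sum]
  -- Step D: the step identity for the lifted source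
  have hbcM := isBlockConst_codiff₁_δSum_lift_M (M := Lc ^ (j + 1)) (T := T) (a := a) hT
  have hbcN := isBlockConst_codiff₁_δSum_lift_N (N := Lc ^ (j + 1 + 1)) (M := Lc ^ (j + 1)) (L := Lc) (T := T) (a := a) hN hT hbc
  rw [eB, eC, tsum_contourSum_GcolSum_mul_wΦ hN _ _ hbcN hbcM κ x]
  -- Step E: weights and the surviving level-`M` multiplier
  have hw : wVH d Lc (j + 1) * ((((Lc ^ (j + 1) : ℕ) : ℝ) ^ (d + 2))⁻¹ * (((Lc ^ (j + 1) : ℕ) : ℝ) ^ (d + 2))⁻¹) = 1 := by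
    rw [← mul_assoc, wVH_mul_inv, stepScale_mul_inv]
  have hs := stepScale_mul_inv (d := d) (Lc := Lc) (j + 1)
  have hΦM : ΦcolSum (N := Lc ^ (j + 1)) (liftSet (Lc ^ (j + 1)) T) (liftWt (Lc ^ (j + 1)) T a) κ x = -a (κ, x) := by
    rw [ΦcolSum_lift]
    have e : ∀ q ∈ T, a q * ∑ i ∈ LegIdx d (Lc ^ (j + 1)),
        GamΦ (N := Lc ^ (j + 1)) κ x q.1 (legPt (Lc ^ (j + 1)) (Sum.inl q.1) q.2 i) =
        -(a q * if q.2 = x ∧ q.1 = κ then 1 else 0) := by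
      intro q _
      rw [← contourSum_Hcol (N := Lc ^ (j + 1)) κ x q.1 q.2, ← sum_LegIdx_eq_contourSum, ← mul_neg, ← Finset.sum_neg_distrib]
      congr 1
      refine Finset.sum_congr rfl fun i _ => ?_
      rw [GamΦ_eq_neg_wH, Hcol_apply]
    rw [Finset.sum_congr rfl e, Finset.sum_neg_distrib]
    congr 1
    by_cases hq : (κ, x) ∈ T
    · rw [Finset.sum_eq_single_of_mem (κ, x) hq (fun q _ hne => by
        rw [if_neg (fun h => hne (Prod.ext h.2 h.1)), mul_zero]), if_pos ⟨rfl, rfl⟩, mul_one]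
    · rw [hT _ hq]
      exact Finset.sum_eq_zero fun q hq' => by
        rw [if_neg (fun h => hq (by rw [← h.1, ← h.2]; exact hq')), mul_zero]
  calc wVH d Lc (j + 1) * (((((Lc ^ (j + 1) : ℕ) : ℝ) ^ (d + 2))⁻¹ * (((Lc ^ (j + 1) : ℕ) : ℝ) ^ (d + 2))⁻¹) *
          (contourSumAdj Lc (ΦcolSum (N := Lc ^ (j + 1 + 1)) (liftSet (Lc ^ (j + 1)) T) (liftWt (Lc ^ (j + 1)) T a)) κ x -
            ΦcolSum (N := Lc ^ (j + 1)) (liftSet (Lc ^ (j + 1)) T) (liftWt (Lc ^ (j + 1)) T a) κ x)) -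
        stepScale d Lc (j + 1) * ((((Lc ^ (j + 1) : ℕ) : ℝ) ^ (d + 2))⁻¹ *
          contourSumAdj Lc (ΦcolSum (N := Lc ^ (j + 1 + 1)) (liftSet (Lc ^ (j + 1)) T) (liftWt (Lc ^ (j + 1)) T a)) κ x)
      = (wVH d Lc (j + 1) * ((((Lc ^ (j + 1) : ℕ) : ℝ) ^ (d + 2))⁻¹ * (((Lc ^ (j + 1) : ℕ) : ℝ) ^ (d + 2))⁻¹)) *
          (contourSumAdj Lc (ΦcolSum (N := Lc ^ (j + 1 + 1)) (liftSet (Lc ^ (j + 1)) T) (liftWt (Lc ^ (j + 1)) T a)) κ x -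
            ΦcolSum (N := Lc ^ (j + 1)) (liftSet (Lc ^ (j + 1)) T) (liftWt (Lc ^ (j + 1)) T a) κ x) -
        (stepScale d Lc (j + 1) * (((Lc ^ (j + 1) : ℕ) : ℝ) ^ (d + 2))⁻¹) *
          contourSumAdj Lc (ΦcolSum (N := Lc ^ (j + 1 + 1)) (liftSet (Lc ^ (j + 1)) T) (liftWt (Lc ^ (j + 1)) T a)) κ x := by ring
    _ = a (κ, x) := by rw [hw, hs, hΦM]; ring

end Pair

end

end Summit.QuantumFields.BalabanUV.Beta.BorderedHessian
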